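import Mathlib
import Summits.NavierStokesRegularity.NavierStokesRegularity.Theorems.LerayQuarterDissipationFiniteDissipationLiouvilleWindowBlobProduction
import HarnessLib

/-!
# Crux `FiniteDissipationLiouville` (stmt-NavierStokesRegularity-22144): THE VORTEX-STRETCHING EXCESS BY A
# DEFINITE FACTOR — windows, volume and blobs with a margin

Theorems file of route `LerayQuarterDissipation` (lead prover g19; `--supports` the crux; completes the
stretching-form instances of `…WindowSocketCollar` / `…WindowBlobSocket`, which so far carried no margin).
Navier–Stokes regularity is NOT proved by anything here; no summit is.

* `stretchingBalance_factor_at_nsRescale` (pointwise scale covariance of `⟪ω, ∇u ω⟫ ≤ θ(|∇ω|²_F + ‖ω‖²/(4(−t)))`),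
  `stretchingBalance_factor_violation_eventually` (violations at factor `1` by a KNSS limit ⇒ violations at
  factors `θ_j → 1` by the approximants), `stretching_factor_ball` (the same on a ball, along `seqLimit₂`);
* **`stretching_excess_margin_in_every_window`** / **`stretching_excess_margin_volume`** — for every `A`:
  `ε(A) ∈ (0,1)`, `δ(A) > 0`, `η(A) > 0` with: every singular enveloped KNSS-gauge Type-I field has in every
  window `[−c², −εc²]` a point — and in the unit window a set of volume `≥ η` — where
  `(1+δ)(|∇ω|²_F + ‖ω‖²/(4(−t))) < ⟪ω, ∇u ω⟫`;
* **`stretching_excess_margin_blob_in_every_window`** — and a whole parabolic cylinder of relative size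
  `ρ(A)` inside every window on which the same strict inequality with the factor `1+δ` holds.

HONEST FRAMING. Compactness corollaries (ineffective constants) about a HYPOTHETICAL singular enveloped
profile; nothing is removed from the DSS wall (`∀ c>1 TypeIDSSLiouville c`, NECESSARY for the crux).
Nothing here bears on NS regularity.

References: Koch–Nadirashvili–Seregin–Šverák, Acta Math. 203 (2009) §4; folklore.
-/

noncomputable section

set_option linter.dupNamespace false

namespace Summit.NavierStokesRegularity.NavierStokesRegularity.Theorems.FiniteDissipationLiouville.WindowRecurrence

open MeasureTheory Set Filter Topology Metric InnerProductSpace Function Real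
open scoped RealInnerProductSpace ContDiff ENNReal
open Literature.Analysis Literature.Analysis.FluidPDE
open Summit.NavierStokesRegularity.ForcedUniquenessCountableJunk (frobeniusNormSq_smul)
open Summit.NavierStokesRegularity.NavierStokesRegularity.Theorems
open Summit.NavierStokesRegularity.NavierStokesRegularity.Theorems.RecurrentReductionD
open Summit.NavierStokesRegularity.NavierStokesRegularity.Theorems.FiniteDissipationLiouville
open Summit.NavierStokesRegularity.NavierStokesRegularity.Theorems.FiniteDissipationLiouville.CrossFlow
open Summit.NavierStokesRegularity.NavierStokesRegularity.Theorems.FiniteDissipationLiouville.EndpointScheme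
open Summit.NavierStokesRegularity.NavierStokesRegularity.Theorems.FiniteDissipationLiouville.LocalBalance
open Summit.NavierStokesRegularity.NavierStokesRegularity.Theorems.FiniteDissipationLiouville.WindowSocket
open Summit.NavierStokesRegularity.NavierStokesRegularity.Theorems.FiniteDissipationLiouville.Compactness

variable {C : ℝ}

/-! ### Bookkeeping with a factor `θ` -/

section Factor

/-- **Pointwise scale covariance of the stretching balance with factor `θ`.** [folklore] -/
theorem stretchingBalance_factor_at_nsRescale (θ : ℝ) (V : ℝ → EuclideanSpace ℝ (Fin 3) → EuclideanSpace ℝ (Fin 3))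
    {c t : ℝ} (x : EuclideanSpace ℝ (Fin 3)) (hc : 0 < c) (ht : t < 0)
    (h : ⟪curl (V (c ^ 2 * t)) (c • x), fderiv ℝ (V (c ^ 2 * t)) (c • x) (curl (V (c ^ 2 * t)) (c • x))⟫ ≤
      θ * (frobeniusNormSq (fderiv ℝ (curl (V (c ^ 2 * t))) (c • x)) +
        ‖curl (V (c ^ 2 * t)) (c • x)‖ ^ 2 / (4 * (-(c ^ 2 * t))))) :
    ⟪curl (nsRescale c V t) x, fderiv ℝ (nsRescale c V t) x (curl (nsRescale c V t) x)⟫ ≤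
      θ * (frobeniusNormSq (fderiv ℝ (curl (nsRescale c V t)) x) + ‖curl (nsRescale c V t) x‖ ^ 2 / (4 * (-t))) := by
  -- adapted from `…LocalBalanceStretchingTools.stretchingBalance_nsRescale` (pointwise form)
  have hcurl : curl (nsRescale c V t) x = (c * c) • curl (V (c ^ 2 * t)) (c • x) := by
    rw [curl_eq_curlCLM, fderiv_nsRescale, map_smul, ← curl_eq_curlCLM]
  rw [hcurl, fderiv_nsRescale, fderiv_curl_nsRescale, frobeniusNormSq_smul,
    _root_.smul_apply, map_smul, real_inner_smul_left,
    real_inner_smul_right, real_inner_smul_right, norm_smul,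
    Real.norm_of_nonneg (by positivity : (0:ℝ) ≤ c * c)]
  have ht' : 0 < -t := neg_pos.2 ht
  have h4 : (4 : ℝ) * (-t) ≠ 0 := by positivity
  have h4c : (4 : ℝ) * (-(c ^ 2 * t)) ≠ 0 := by
    rw [show (4 : ℝ) * (-(c ^ 2 * t)) = c ^ 2 * (4 * (-t)) by ring]; positivity
  have e1 : (c * c * ‖curl (V (c ^ 2 * t)) (c • x)‖) ^ 2 / (4 * (-t)) =
      c ^ 6 * (‖curl (V (c ^ 2 * t)) (c • x)‖ ^ 2 / (4 * (-(c ^ 2 * t)))) := by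
    rw [mul_div_assoc', div_eq_div_iff h4 h4c]
    ring
  rw [e1]
  have hw : 0 ≤ c ^ 6 := by positivity
  calc c * c * (c * c * (c * c *
        ⟪curl (V (c ^ 2 * t)) (c • x), fderiv ℝ (V (c ^ 2 * t)) (c • x) (curl (V (c ^ 2 * t)) (c • x))⟫))
      = c ^ 6 * ⟪curl (V (c ^ 2 * t)) (c • x),
          fderiv ℝ (V (c ^ 2 * t)) (c • x) (curl (V (c ^ 2 * t)) (c • x))⟫ := by ring
    _ ≤ c ^ 6 * (θ * (frobeniusNormSq (fderiv ℝ (curl (V (c ^ 2 * t))) (c • x)) +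
          ‖curl (V (c ^ 2 * t)) (c • x)‖ ^ 2 / (4 * (-(c ^ 2 * t))))) :=
        mul_le_mul_of_nonneg_left h hw
    _ = θ * ((c * c * c) ^ 2 * frobeniusNormSq (fderiv ℝ (curl (V (c ^ 2 * t))) (c • x)) +
          c ^ 6 * (‖curl (V (c ^ 2 * t)) (c • x)‖ ^ 2 / (4 * (-(c ^ 2 * t))))) := by ring

/-- **Violations of the stretching balance pass to the approximants with factors `θ_j → 1`.**
[cite: KochNadirashviliSereginSverak2009, Prop. 4.1 (arXiv:0709.3599 p. 8)] -/
theorem stretchingBalance_factor_violation_eventually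
    {v : ℕ → ℝ → EuclideanSpace ℝ (Fin 3) → EuclideanSpace ℝ (Fin 3)}
    {W : ℝ → EuclideanSpace ℝ (Fin 3) → EuclideanSpace ℝ (Fin 3)} {θ : ℕ → ℝ}
    (hv : ∀ j, IsTypeIAncientMild C (v j)) (hW : IsTypeIAncientMild C W)
    (hunif : ∀ n : ℕ, TendstoUniformlyOn (fun j z => v j z.1 z.2) (fun z => W z.1 z.2) atTop
      (Icc (-((n : ℝ) + 2)) (-(1 / ((n : ℝ) + 2))) ×ˢ
        closedBall (0 : EuclideanSpace ℝ (Fin 3)) ((n : ℝ) + 2)))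
    (hgr : ∀ t < 0, ∀ x, Tendsto (fun j => fderiv ℝ (v j t) x) atTop (𝓝 (fderiv ℝ (W t) x)))
    (hθ : Tendsto θ atTop (𝓝 1)) {t : ℝ} (ht : t < 0) (x : EuclideanSpace ℝ (Fin 3))
    (hbad : ¬ ⟪curl (W t) x, fderiv ℝ (W t) x (curl (W t) x)⟫ ≤
      1 * (frobeniusNormSq (fderiv ℝ (curl (W t)) x) + ‖curl (W t) x‖ ^ 2 / (4 * (-t)))) :
    ∀ᶠ j in atTop, ¬ ⟪curl (v j t) x, fderiv ℝ (v j t) x (curl (v j t) x)⟫ ≤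
      θ j * (frobeniusNormSq (fderiv ℝ (curl (v j t)) x) + ‖curl (v j t) x‖ ^ 2 / (4 * (-t))) := by
  have htb : Tendsto (fun j => curl (v j t) x) atTop (𝓝 (curl (W t) x)) :=
    tendsto_curl_of_fderiv (hgr t ht x)
  have htG : Tendsto (fun j => fderiv ℝ (curl (v j t)) x) atTop (𝓝 (fderiv ℝ (curl (W t)) x)) :=
    tendsto_fderiv_curl_of_unif hv hW hunif ht x
  have hLb : Tendsto (fun j => fderiv ℝ (v j t) x (curl (v j t) x)) atTop
      (𝓝 (fderiv ℝ (W t) x (curl (W t) x))) := tendsto_clm_apply_of_tendsto (hgr t ht x) htb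
  have hL : Tendsto (fun j => ⟪curl (v j t) x, fderiv ℝ (v j t) x (curl (v j t) x)⟫) atTop
      (𝓝 ⟪curl (W t) x, fderiv ℝ (W t) x (curl (W t) x)⟫) := htb.inner hLb
  have hR : Tendsto (fun j => θ j * (frobeniusNormSq (fderiv ℝ (curl (v j t)) x) +
      ‖curl (v j t) x‖ ^ 2 / (4 * (-t)))) atTop
      (𝓝 (1 * (frobeniusNormSq (fderiv ℝ (curl (W t)) x) + ‖curl (W t) x‖ ^ 2 / (4 * (-t))))) :=
    hθ.mul (((continuous_frobeniusNormSq'.tendsto _).comp htG).add ((htb.norm.pow 2).div_const _))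
  rw [not_le] at hbad
  filter_upwards [hR.eventually_lt hL hbad] with j hj
  exact not_le.2 hj

/-- **Ball transfer for the stretching balance with factors `θ_j → 1`** (along `seqLimit₂`).
[cite: KochNadirashviliSereginSverak2009, Prop. 4.1 (arXiv:0709.3599 p. 8)] -/
theorem stretching_factor_ball {v : ℕ → ℝ → EuclideanSpace ℝ (Fin 3) → EuclideanSpace ℝ (Fin 3)}
    {W : ℝ → EuclideanSpace ℝ (Fin 3) → EuclideanSpace ℝ (Fin 3)} {θ : ℕ → ℝ}
    (hv : ∀ j, IsTypeIAncientMild C (v j)) (hW : IsTypeIAncientMild C W)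
    (hunif : ∀ n : ℕ, TendstoUniformlyOn (fun j z => v j z.1 z.2) (fun z => W z.1 z.2) atTop
      (Icc (-((n : ℝ) + 2)) (-(1 / ((n : ℝ) + 2))) ×ˢ
        closedBall (0 : EuclideanSpace ℝ (Fin 3)) ((n : ℝ) + 2)))
    (hunifG : ∀ n : ℕ, TendstoUniformlyOn (fun j z => fderiv ℝ (v j z.1) z.2) (fun z => fderiv ℝ (W z.1) z.2)
      atTop (Icc (-((n : ℝ) + 2)) (-(1 / ((n : ℝ) + 2))) ×ˢ
        closedBall (0 : EuclideanSpace ℝ (Fin 3)) ((n : ℝ) + 2)))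
    (hunifH : ∀ n : ℕ, TendstoUniformlyOn (fun j z => fderiv ℝ (fderiv ℝ (v j z.1)) z.2)
      (fun z => fderiv ℝ (fderiv ℝ (W z.1)) z.2)
      atTop (Icc (-((n : ℝ) + 2)) (-(1 / ((n : ℝ) + 2))) ×ˢ
        closedBall (0 : EuclideanSpace ℝ (Fin 3)) ((n : ℝ) + 2)))
    (hθ : Tendsto θ atTop (𝓝 1)) {t₀ : ℝ} (ht₀ : t₀ < 0) (x₀ : EuclideanSpace ℝ (Fin 3))
    (hbad : ¬ ⟪curl (W t₀) x₀, fderiv ℝ (W t₀) x₀ (curl (W t₀) x₀)⟫ ≤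
      1 * (frobeniusNormSq (fderiv ℝ (curl (W t₀)) x₀) + ‖curl (W t₀) x₀‖ ^ 2 / (4 * (-t₀)))) :
    ∃ r : ℝ, 0 < r ∧ ∀ᶠ j in atTop, ∀ q : ℝ × EuclideanSpace ℝ (Fin 3), dist q (t₀, x₀) < r →
      ¬ ⟪curl (v j q.1) q.2, fderiv ℝ (v j q.1) q.2 (curl (v j q.1) q.2)⟫ ≤
        θ j * (frobeniusNormSq (fderiv ℝ (curl (v j q.1)) q.2) + ‖curl (v j q.1) q.2‖ ^ 2 / (4 * (-q.1))) := by
  obtain ⟨s, hs, hT, -, h1, -, h3, h4⟩ := jet_tendsto_prod hv hW hunif hunifG hunifH ht₀ x₀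
  have hLb := tendsto_clm_apply_filter h3 h1
  have hL : Tendsto (fun q : ℕ × (ℝ × EuclideanSpace ℝ (Fin 3)) =>
      ⟪curl (v q.1 q.2.1) q.2.2, fderiv ℝ (v q.1 q.2.1) q.2.2 (curl (v q.1 q.2.1) q.2.2)⟫)
      (atTop ×ˢ 𝓝[s] (t₀, x₀)) (𝓝 ⟪curl (W t₀) x₀, fderiv ℝ (W t₀) x₀ (curl (W t₀) x₀)⟫) := h1.inner hLb
  have hθ' : Tendsto (fun q : ℕ × (ℝ × EuclideanSpace ℝ (Fin 3)) => θ q.1) (atTop ×ˢ 𝓝[s] (t₀, x₀)) (𝓝 1) :=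
    hθ.comp tendsto_fst
  have hden : Tendsto (fun q : ℕ × (ℝ × EuclideanSpace ℝ (Fin 3)) => 4 * (-q.2.1))
      (atTop ×ˢ 𝓝[s] (t₀, x₀)) (𝓝 (4 * (-t₀))) := (hT.neg).const_mul 4
  have hden0 : (4 : ℝ) * (-t₀) ≠ 0 := by
    have : 0 < -t₀ := neg_pos.2 ht₀
    positivity
  have hR : Tendsto (fun q : ℕ × (ℝ × EuclideanSpace ℝ (Fin 3)) =>
      θ q.1 * (frobeniusNormSq (fderiv ℝ (curl (v q.1 q.2.1)) q.2.2) +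
        ‖curl (v q.1 q.2.1) q.2.2‖ ^ 2 / (4 * (-q.2.1))))
      (atTop ×ˢ 𝓝[s] (t₀, x₀))
      (𝓝 (1 * (frobeniusNormSq (fderiv ℝ (curl (W t₀)) x₀) + ‖curl (W t₀) x₀‖ ^ 2 / (4 * (-t₀))))) :=
    hθ'.mul (((continuous_frobeniusNormSq'.tendsto _).comp h4).add ((h1.norm.pow 2).div hden hden0))
  rw [not_le] at hbad
  have hev := hR.eventually_lt hL hbad
  obtain ⟨r, hr, hball⟩ := exists_ball_eventually_of_prod_nhds hs hev
  exact ⟨r, hr, hball.mono fun j hj q hq => not_le.2 (hj q hq)⟩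

end Factor

/-! ### Windows, volume and blobs with a margin -/

section Margin

/-- **THE STRETCHING EXCESS BY A DEFINITE FACTOR RECURS IN EVERY WINDOW.**
[folklore compactness; cite: KochNadirashviliSereginSverak2009, §4 (arXiv:0709.3599 p. 8)] -/
theorem stretching_excess_margin_in_every_window (A : ℝ) : ∃ ε : ℝ, 0 < ε ∧ ε < 1 ∧ ∃ δ : ℝ, 0 < δ ∧
    ∀ (C : ℝ) (V : ℝ → EuclideanSpace ℝ (Fin 3) → EuclideanSpace ℝ (Fin 3)),
      IsTypeIAncientMild C V → C ≤ A → HasTypeIDecay A V →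
      (∀ r > 0, ∀ M : ℝ, ∃ t ∈ Ioo (-(r ^ 2)) (0 : ℝ),
        ∃ x ∈ ball (0 : EuclideanSpace ℝ (Fin 3)) r, M < ‖V t x‖) →
      ∀ c : ℝ, 0 < c → ∃ t ∈ Icc (-c ^ 2) (-(ε * c ^ 2)), ∃ x : EuclideanSpace ℝ (Fin 3),
        (1 + δ) * (frobeniusNormSq (fderiv ℝ (curl (V t)) x) + ‖curl (V t) x‖ ^ 2 / (4 * (-t))) <
          ⟪curl (V t) x, fderiv ℝ (V t) x (curl (V t) x)⟫ := by
  obtain ⟨ε, hε, hε1, δ, hδ, h⟩ := exists_window_margin_of_apex_kill_envelope (C := A) (θ₀ := 1)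
    (G := fun θ F t x => ⟪curl (F t) x, fderiv ℝ (F t) x (curl (F t) x)⟫ ≤
      θ * (frobeniusNormSq (fderiv ℝ (curl (F t)) x) + ‖curl (F t) x‖ ^ 2 / (4 * (-t))))
    (fun θ F c t x hc ht hG => stretchingBalance_factor_at_nsRescale θ F x hc ht hG)
    (fun u W θ hu hW hunif hpt hgr hθ t ht x hbad =>
      stretchingBalance_factor_violation_eventually hu hW hunif hgr hθ ht x hbad)
    (fun W hW hdW hG => not_singular_of_stretchingBalance_near_apex hW hdW (τ := -1/2) (by norm_num)
      fun t h1 h2 x => by have := hG t (by linarith) h2 x; rwa [one_mul] at this)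
  refine ⟨ε, hε, hε1, δ, hδ, fun C V hV hCA hdec hsing c hc => ?_⟩
  obtain ⟨t, ht, x, hx⟩ := h V (isTypeIAncientMild_of_le hV hCA) hdec hsing c hc
  exact ⟨t, ht, x, not_le.1 hx⟩

/-- **… ON A SET OF DEFINITE VOLUME IN THE UNIT WINDOW.**
[folklore compactness; cite: KochNadirashviliSereginSverak2009, §4 (arXiv:0709.3599 p. 8)] -/
theorem stretching_excess_margin_volume (A : ℝ) : ∃ ε : ℝ, 0 < ε ∧ ε < 1 ∧ ∃ δ : ℝ, 0 < δ ∧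
    ∃ η : ℝ, 0 < η ∧
    ∀ (C : ℝ) (V : ℝ → EuclideanSpace ℝ (Fin 3) → EuclideanSpace ℝ (Fin 3)),
      IsTypeIAncientMild C V → C ≤ A → HasTypeIDecay A V →
      (∀ r > 0, ∀ M : ℝ, ∃ t ∈ Ioo (-(r ^ 2)) (0 : ℝ),
        ∃ x ∈ ball (0 : EuclideanSpace ℝ (Fin 3)) r, M < ‖V t x‖) →
      ENNReal.ofReal η ≤ volume {p : ℝ × EuclideanSpace ℝ (Fin 3) | p.1 ∈ Icc (-1 : ℝ) (-ε) ∧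
        (1 + δ) * (frobeniusNormSq (fderiv ℝ (curl (V p.1)) p.2) + ‖curl (V p.1) p.2‖ ^ 2 / (4 * (-p.1))) <
          ⟪curl (V p.1) p.2, fderiv ℝ (V p.1) p.2 (curl (V p.1) p.2)⟫} := by
  obtain ⟨ε, hε, hε1, δ, hδ, η, hη, h⟩ := exists_window_margin_volume_of_apex_kill_envelope (C := A)
    (θ₀ := 1)
    (G := fun θ F t x => ⟪curl (F t) x, fderiv ℝ (F t) x (curl (F t) x)⟫ ≤
      θ * (frobeniusNormSq (fderiv ℝ (curl (F t)) x) + ‖curl (F t) x‖ ^ 2 / (4 * (-t))))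
    (fun u W θ hu hW hunif hpt hgr hθ t ht x hbad =>
      stretchingBalance_factor_violation_eventually hu hW hunif hgr hθ ht x hbad)
    (fun θ U hU _ => by
      -- openness: the violation set of the balance with factor `θ` (joint continuity of the 2-jet)
      have hS : IsOpen (Iio (0:ℝ) ×ˢ (univ : Set (EuclideanSpace ℝ (Fin 3)))) := isOpen_Iio.prod isOpen_univ
      have hb := continuousOn_curl hU
      have hD := continuousOn_fderiv hU
      have hG := continuousOn_fderiv_curl hU
      have hL : ContinuousOn (fun p : ℝ × EuclideanSpace ℝ (Fin 3) =>
          ⟪curl (U p.1) p.2, fderiv ℝ (U p.1) p.2 (curl (U p.1) p.2)⟫) (Iio 0 ×ˢ univ) :=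
        hb.inner (continuousOn_clm_apply hD hb)
      have ht : ContinuousOn (fun p : ℝ × EuclideanSpace ℝ (Fin 3) => 4 * (-p.1)) (Iio 0 ×ˢ univ) :=
        (continuous_const.mul continuous_fst.neg).continuousOn
      have hR : ContinuousOn (fun p : ℝ × EuclideanSpace ℝ (Fin 3) =>
          θ * (frobeniusNormSq (fderiv ℝ (curl (U p.1)) p.2) + ‖curl (U p.1) p.2‖ ^ 2 / (4 * (-p.1))))
          (Iio 0 ×ˢ univ) := by
        refine ((continuous_frobeniusNormSq'.comp_continuousOn hG).add ((hb.norm.pow 2).div ht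
          fun p hp => ?_)).const_smul θ
        have : p.1 < 0 := hp.1
        exact mul_ne_zero four_ne_zero (neg_ne_zero.2 this.ne)
      have hO := (hL.sub hR).isOpen_inter_preimage hS (isOpen_Ioi (a := (0:ℝ)))
      convert hO using 1
      ext p
      simp only [mem_setOf_eq, mem_inter_iff, mem_prod, mem_Iio, mem_univ, and_true, mem_preimage,
        mem_Ioi, Pi.sub_apply, sub_pos, not_le])
    (fun W hW hdW hG => not_singular_of_stretchingBalance_near_apex hW hdW (τ := -1/2) (by norm_num)
      fun t h1 h2 x => by have := hG t (by linarith) h2 x; rwa [one_mul] at this)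
  refine ⟨ε, hε, hε1, δ, hδ, η, hη, fun C V hV hCA hdec hsing => ?_⟩
  exact (h V (isTypeIAncientMild_of_le hV hCA) hdec hsing).trans
    (measure_mono fun p hp => ⟨hp.1, not_le.1 hp.2⟩)

/-- **THE STRETCHING EXCESS BY A DEFINITE FACTOR FILLS A PARABOLIC CYLINDER IN EVERY WINDOW.**
[folklore compactness; cite: KochNadirashviliSereginSverak2009, §4 (arXiv:0709.3599 p. 8)] -/
theorem stretching_excess_margin_blob_in_every_window (A : ℝ) : ∃ ε : ℝ, 0 < ε ∧ ε < 1 ∧ ∃ ρ : ℝ, 0 < ρ ∧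
    ∃ δ : ℝ, 0 < δ ∧
    ∀ (C : ℝ) (V : ℝ → EuclideanSpace ℝ (Fin 3) → EuclideanSpace ℝ (Fin 3)),
      IsTypeIAncientMild C V → C ≤ A → HasTypeIDecay A V →
      (∀ r > 0, ∀ M : ℝ, ∃ t ∈ Ioo (-(r ^ 2)) (0 : ℝ),
        ∃ x ∈ ball (0 : EuclideanSpace ℝ (Fin 3)) r, M < ‖V t x‖) →
      ∀ c : ℝ, 0 < c → ∃ (t₀ : ℝ) (x₀ : EuclideanSpace ℝ (Fin 3)),
        Icc (t₀ - (ρ * c) ^ 2) t₀ ⊆ Icc (-c ^ 2) (-(ε * c ^ 2)) ∧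
        ∀ t ∈ Icc (t₀ - (ρ * c) ^ 2) t₀, ∀ x ∈ ball x₀ (ρ * c),
          (1 + δ) * (frobeniusNormSq (fderiv ℝ (curl (V t)) x) + ‖curl (V t) x‖ ^ 2 / (4 * (-t))) <
            ⟪curl (V t) x, fderiv ℝ (V t) x (curl (V t) x)⟫ := by
  obtain ⟨ε, hε, hε1, ρ, hρ, δ, hδ, h⟩ := exists_blob_margin_of_apex_kill_envelope (C := A) (θ₀ := 1)
    (G := fun θ F t x => ⟪curl (F t) x, fderiv ℝ (F t) x (curl (F t) x)⟫ ≤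
      θ * (frobeniusNormSq (fderiv ℝ (curl (F t)) x) + ‖curl (F t) x‖ ^ 2 / (4 * (-t))))
    (fun u W θ hu hW hunif hunifG hunifH hθ t₀ ht₀ x₀ hbad =>
      stretching_factor_ball hu hW hunif hunifG hunifH hθ ht₀ x₀ hbad)
    (fun W hW hdW hG => not_singular_of_stretchingBalance_near_apex hW hdW (τ := -1/2) (by norm_num)
      fun t h1 h2 x => by have := hG t (by linarith) h2 x; rwa [one_mul] at this)
  refine ⟨ε, hε, hε1, ρ, hρ, δ, hδ, fun C V hV hCA hdec hsing c hc => ?_⟩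
  obtain ⟨t₀, x₀, hwin, hblob⟩ := h (nsRescale c V) ((isTypeIAncientMild_of_le hV hCA).nsRescale hc)
    (hdec.nsRescale hc) (singularAtOrigin_nsRescale hsing hc)
  obtain ⟨hwin', hblob'⟩ := blob_rescale (θ := 1 + δ) (ε := ε) (ρ := ρ) (c := c)
    (G := fun θ F t x => ⟪curl (F t) x, fderiv ℝ (F t) x (curl (F t) x)⟫ ≤
      θ * (frobeniusNormSq (fderiv ℝ (curl (F t)) x) + ‖curl (F t) x‖ ^ 2 / (4 * (-t))))
    (fun F c' t x hc' ht hG => stretchingBalance_factor_at_nsRescale (1 + δ) F x hc' ht hG) hc hε hwin hblob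
  exact ⟨c ^ 2 * t₀, c • x₀, hwin', fun t ht x hx => not_le.1 (hblob' t ht x hx)⟩

end Margin

end Summit.NavierStokesRegularity.NavierStokesRegularity.Theorems.FiniteDissipationLiouville.WindowRecurrence

end
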